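import Summits.Ventures.QEC.Census.LP.LP144w5d12.BZKernelZ3
import Summits.Ventures.QEC.Census.CertBZPlaneSound
import Summits.Ventures.QEC.Census.CertBZInfoSets
import Summits.Ventures.QEC.Census.CertChunks
import Summits.Ventures.QEC.Census.LP.LP144w5d12.Cert
import HarnessLib

/-!
# `LP144w5d12` — `Z`-side Brouwer–Zimmermann replay, file BZKernelZ5: units b0m1s12 … b0m1s17 (b = block, m = matrix; h = head, s = lane segment, e = matrix verdict, t = block verdict) (tier KERNEL; lane engine for the enumeration)

census row `LPb_2x2_l36_b0-1-11_E0-0.0-3` (family LP) is `[[144, 4, 12]]`.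
Per block `b` of `LP144w5d12.bzData.sideZ`: systematic forms `sysZ_b_i` (`DistCert.bzZSys`), the recounted bound `boundZ_b`
(`bzZBound`), lane segments `psegZ_b_i_k` (`Plane.segOK`, type-01's lane-parallel Brouwer–Zimmermann replay, `Census/CertBZPlane*.lean`),
the enumeration verdicts `enumZ_b_i` (`DistCert.bzZEnum_of_reaches` + `Plane.reaches_of_segList`) and the block verdict `blkZ_b`
(`DistCert.bzZBlock_of_parts`) — decl names and proof terms = the row lanes of qec-search-7 / qec-type-01 (emit_compact_row.side_file).
Every `decide` runs in the kernel (`decide +kernel`); axioms standard; `Elab.async false` (gate memory guard).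
-/

set_option autoImplicit false
set_option Elab.async false

namespace Summit.Ventures.QEC.Census.LP144w5d12

open Summit.Ventures.QEC.Census

set_option maxHeartbeats 400000000 in
/-- Block 0, matrix 1, lane segment `[61, 62)` (559737 lanes, 103 allow-listed stragglers): every selection with largest row there passes (lane engine, KERNEL). -/
theorem psegZ_0_1_12 : Plane.segOK 144 11 (LP144w5d12.cert.sideZ.found.map Prod.fst) LP144w5d12.pG_0_1 5 61 1 4292 = true := by
  decide +kernel
set_option maxHeartbeats 400000000 in
/-- Block 0, matrix 1, lane segment `[62, 63)` (597619 lanes, 83 allow-listed stragglers): every selection with largest row there passes (lane engine, KERNEL). -/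
theorem psegZ_0_1_13 : Plane.segOK 144 11 (LP144w5d12.cert.sideZ.found.map Prod.fst) LP144w5d12.pG_0_1 5 62 1 4292 = true := by
  decide +kernel
set_option maxHeartbeats 400000000 in
/-- Block 0, matrix 1, lane segment `[63, 64)` (637393 lanes, 108 allow-listed stragglers): every selection with largest row there passes (lane engine, KERNEL). -/
theorem psegZ_0_1_14 : Plane.segOK 144 11 (LP144w5d12.cert.sideZ.found.map Prod.fst) LP144w5d12.pG_0_1 5 63 1 4292 = true := by
  decide +kernel
set_option maxHeartbeats 400000000 in
/-- Block 0, matrix 1, lane segment `[64, 65)` (679121 lanes, 93 allow-listed stragglers): every selection with largest row there passes (lane engine, KERNEL). -/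
theorem psegZ_0_1_15 : Plane.segOK 144 11 (LP144w5d12.cert.sideZ.found.map Prod.fst) LP144w5d12.pG_0_1 5 64 1 4292 = true := by
  decide +kernel
set_option maxHeartbeats 400000000 in
/-- Block 0, matrix 1, lane segment `[65, 66)` (722866 lanes, 120 allow-listed stragglers): every selection with largest row there passes (lane engine, KERNEL). -/
theorem psegZ_0_1_16 : Plane.segOK 144 11 (LP144w5d12.cert.sideZ.found.map Prod.fst) LP144w5d12.pG_0_1 5 65 1 4292 = true := by
  decide +kernel
set_option maxHeartbeats 400000000 in
/-- Block 0, matrix 1, lane segment `[66, 67)` (768692 lanes, 122 allow-listed stragglers): every selection with largest row there passes (lane engine, KERNEL). -/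
theorem psegZ_0_1_17 : Plane.segOK 144 11 (LP144w5d12.cert.sideZ.found.map Prod.fst) LP144w5d12.pG_0_1 5 66 1 4292 = true := by
  decide +kernel
end Summit.Ventures.QEC.Census.LP144w5d12
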